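import Summits.ABC.IUTFork.Repair.RHHullCellSlackSum
import Summits.ABC.IUTFork.Repair.RHHullCellSlackLaw
import HarnessLib

/-!
# R-H ROUND 3 — FIN-REACH: licence at ONE label `n` FINANCES the labels up to `≈ 3n/2` (abc-iut-rh3-gen-2's integer lemma (A)), in kernel

PROOF-ONLY file (0 definitions, 0 `Prop` facts, no instance, no notation) of the abc-iut cell (D-0079 RESCUE sub-cell R-H, rung
LADDER-ABC:A2.RESCUE.H); seat abc-iut-rh2-q2-cond (gen 5) taking the unowned kernel companion of abc-iut-rh3-gen-2's «FINANCED EDITION OF THE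
UNIFORM LABEL CUT» (HOME/STATUS 2026-08-27T02:09:22Z (A) «FIN-REACH LEMMA»; referee word abc-iut-rh3-ref-1 02:11:25Z TEST A PASS =
VARIANT(R18) + INSTRUMENT, socket L2, booking B46; lead ruling R25 «= the pre-registered expectation of D-0121 LP-2»; D0121-SPEC §1.1 LP-2
«closed form on a pure place = rh3-gen-2 FIN-REACH lemma»). TAKES NO SIDE on [IUTchIII] Cor. 3.12 or on any author; nothing here asserts abc;
every statement is integer arithmetic about OUR typed exact U2 cell `RH.DiffPricedHull.HullCellδ e m j δ r_in r_out`
(`:⟺ e·⌊(j²m − jδ − (j+1)r_in)/e⌋ ≤ m − (j+1)·r_out`, a CONJECTURED column formula of the typed hull), over abc-iut-rh-typ-3's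
`RHHullCellSlackSum` (p484728: `sum_price_ge`, `six_mul_sum_demand_eq`) and abc-iut-rh2-tab-2's `RHHullCellSlackLaw` (p484618:
`margin_eq_price_sub_demand`) and abc-iut-rh2-w-2's `RHHullCellSlice` (`hullCellδ_iff_demand_le_price`, `gain_bounds`) — cited BY NAME,
nothing restated, no file of theirs edited.

CURRENCY (spelled out in every statement, no `def`; MIN-SLICE §(i)/(i-w2).1, D0121-SPEC §1.0): at a bad place with `e = e_w > 0`,
`m = m_q ≥ 0`, different exponent `δ`, `G := r_in − r_out ≥ 0`, label `j ≥ 1`: DEMAND `d_j := (j²−1)·m`; PRICE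
`price_j := j·δ + (j+1)·G + ρ_j`, `ρ_j := (j²m − jδ − (j+1)r_in) mod e ∈ [0, e−1]`; the cell holds at `j` iff `d_j ≤ price_j`; EXACT SLACK
`s_j := price_j − d_j` (`= m − (e·⌊A_j/e⌋ + (j+1)·r_out)`, `A_j := j²m − jδ − (j+1)r_in` — the R-W table's `margin_U2cell`, the per-place
integer that abc-iut-rh-typ-4's `RHCellSlackExact.cellSlack_settingPrVolSharp_eq` (p481438) reads at the diagonal packet). Labels `1, …, L` are
written `j = 1 + k`, `k < L`.

WHAT IS PROVED (namespace `Summit.ABC.IUTFork.Repair.RH.HullCellSlackFinReach`):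
* §1 `licence_cross_mul_of_hullCellδ` — licence at the ONE label `n`, cross-multiplied: `HullCellδ e m n δ r_in r_out ⟹
  m·n² − m − G − (e−1) ≤ n·(δ+G)` (`price_n ≤ nδ + (n+1)G + (e−1)`); floor-free twin `licence_cross_mul_of_linear`.
* §2 `finReach_identity` — the polynomial identity `3(L+1)(n²−1) − n(L−1)(2L+5) = (L+1)·n·(3n−2L−1) + 3(2n−L−1)` (`ring`).
* §3 `n_mul_six_mul_sum_slack_ge` — THE QUANTITATIVE FORM (no sign hypothesis on `m`, `δ`):
  `n·6·Σ_{j=1}^{L} s_j ≥ L·[(L+1)·(m·n·(3n−2L−1) − 3(e−1)) + 3(m+G)·(2n−L−1)]` (`0 < e`, `0 ≤ n`, licence at `n`), and its floor-free twin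
  `n_mul_six_mul_sum_slack_ge_of_linear` (the `3(e−1)` gone).
* §4 **FIN-REACH** `sum_slack_nonneg_of_hullCellδ` — «`0 < e`, `0 ≤ m`, `0 ≤ δ`, `r_out ≤ r_in`, `1 ≤ n`, `HullCellδ` at `n`,
  `3(e−1) ≤ m·n·(3n−2L−1)` ⟹ `0 ≤ Σ_{j=1}^{L} (price_j − d_j)`» — abc-iut-rh3-gen-2's lemma (A) verbatim PLUS the hypothesis `0 ≤ δ`
  (NEEDED: `m = 0`, `e = 1`, `δ = −2`, `G = 1`, `n = 1`, `L = 3` satisfies every other hypothesis with `Σ = −3`; at a cell `δ = e_w·d_w ≥ e−1 ≥ 0`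
  always); `sum_slack_nonneg_of_hullCellδ_of_pos` — the same for `0 < m` with NO `δ`-hypothesis; `sum_slack_nonneg_of_hullCellδ_of_le` — the same
  for `0 ≤ m`, `L ≤ 2n−1`, NO `δ`-hypothesis (the three repairs of the `m = 0` corner found independently by abc-iut-rh3-tst-1 TEST-G2-FIN
  939e03a2234cab62, exhaustive box: «REPAIRED by ANY ONE of 1 ≤ m / 0 ≤ δ / L ≤ 2n − 1», `r_out ≤ r_in` load-bearing, allowance needed); door sign `sum_deficit_nonpos_of_hullCellδ`
  (`Σ_{j≤L} (d_j − price_j) ≤ 0`, the shape of the weighted door p480491's netted hypothesis at `ω = 𝟙{j ≤ L}`); R-W-margin form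
  `sum_margin_nonneg_of_hullCellδ` (`Σ_{j≤L} (m − (e⌊A_j/e⌋ + (j+1)r_out)) ≥ 0`).
* §5 COROLLARIES: `sum_slack_nonneg_of_hullCellδ_of_allowance` (`3(e−1) ≤ m·n·A ∧ 2L + 1 + A ≤ 3n`: reach `⌊(3n−1−A)/2⌋` with the
  floor allowance `A`); `sum_slack_nonneg_of_linear` (floor-free licence `(n²−1)m ≤ nδ + (n+1)G` ⟹ reach `⌊(3n−1)/2⌋` FLAT: every `L` with
  `2L+1 ≤ 3n`, no `δ`-sign, no allowance); `reach_hyp_mono` (the reach hypothesis is downward closed in `L`); `two_mul_le_of_reach_hyp`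
  (`0 < m`, `1 ≤ n` ⟹ the hypothesis forces `2L + 1 ≤ 3n`).
* §6 WORKED ROW (abc-iut-rh3-gen-2 §0 / rh3-ref-1 G6, FREY `p = 7`, `l = 107`: `e = 1605`, `m = 210`, `δ = 1604`, `r_in = 268`,
  `r_out = −4472`, `l⋆ = 53`): `row_frey7_l107_boundary` (`HullCellδ` at `31`, not at `32`: `j₀ = 31`), `row_frey7_l107_reach`
  (`3(e−1) = 4812 ≤ 210·31·(93 − 2L − 1)` at `L = 45`, not at `L = 46`: lemma reach `45`, `(3n−1)/2 = 46`), and the instantiated conclusion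
  `row_frey7_l107_financed` (`0 ≤ Σ_{j ≤ 45} s_j` at these numerals, from §4) and `row_frey7_l107_exact_reach` (by `decide`: `Σ_{j≤46} s_j = 86944`,
  `Σ_{j≤47} s_j = −73760`, whole place `Σ_{j≤53} s_j = −1332482`: exact `J⋆ = 46`, place not wholly financed) — theorems about the listed
  integers; their link to the datum is the R-W WINDOW-TABLE's certificate, computed ≠ proved.
READING (docstrings only; D0121-SPEC §1.1 LP-2 (2a), rh3-gen-2 (B), rh3-ref-1 TEST A): with `n = ⌈κ·l⋆⌉` licensed, the netted slack of the
labels `1 … L` is non-negative for every `L ≤ (3n−1)/2 − (allowance ≤ ⌈3(e−1)/(2mn)⌉)`, so the indicator weight `ω = 𝟙{j ≤ L}` meets the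
weighted door's aggregate hypothesis AT THAT PLACE in the exact model — «licence at ONE label n FINANCES the labels up to ≈ 3n/2» (WORDING GUARD
8.5: financed cells carry NO licence, C7′; the door is [W] p480491, never a per-cell credit [PC]); whole place financed iff
`m·n·(3n − 2l⋆ − 1) ≥ 3(e−1)` (LAW A's integer certificate). Whether any genuine datum supplies the licence at `n`, and what the door then
yields, is NOT this file's business (topt-lp-1 / topt-lp-2 tables, topt-pv-3 glue).
HONEST FRAMING: integer identities/inequalities about OUR typed cell; nothing here asserts that abc is proved or refuted, that [IUTchIII]
Cor. 3.12 holds or fails at any datum, or takes a side on any author; typed ≠ proved; computed ≠ proved.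
[cite: Mochizuki2012, IUTchIV Prop. 1.2 (i)(ii) p. 10, Prop. 1.4 p. 13; IUTchIII Cor. 3.12 p. 173–174] [claim: Mochizuki2012, status: disputed]
-/

namespace Summit.ABC.IUTFork.Repair.RH.HullCellSlackFinReach

open Finset
open Summit.ABC.IUTFork.Repair.RH.DiffPricedHull Summit.ABC.IUTFork.Repair.RH.HullCellSlice
open Summit.ABC.IUTFork.Repair.RH.HullCellSlackSum Summit.ABC.IUTFork.Repair.RH.HullCellSlackLaw

/-! ## §1. Licence at ONE label, cross-multiplied -/

/-- **Licence at the label `n`, cross-multiplied**: `HullCellδ e m n δ r_in r_out ⟹ m·n² − m − (r_in − r_out) − (e−1) ≤ n·(δ + (r_in − r_out))`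
(`0 < e`; from the ledger form `(n²−1)m ≤ nδ + (n+1)G + ρ_n` and `ρ_n ≤ e − 1`). abc-iut-rh3-gen-2 (A): «n(δ+G) ≥ mn² − (m+G+e−1)». [folklore] -/
theorem licence_cross_mul_of_hullCellδ {e m n δ rin rout : ℤ} (he : 0 < e) (h : HullCellδ e m n δ rin rout) :
    m * n ^ 2 - m - (rin - rout) - (e - 1) ≤ n * (δ + (rin - rout)) := by
  have h1 := linear_of_hullCellδ he h
  linarith

/-- Floor-free twin: the floor-free licence `(n²−1)·m ≤ n·δ + (n+1)·(r_in − r_out)` (the sufficient half `hullCellδ_of_linear`'s hypothesis)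
gives `m·n² − m − (r_in − r_out) ≤ n·(δ + (r_in − r_out))` with NO `e − 1`. [folklore] -/
theorem licence_cross_mul_of_linear {m n δ rin rout : ℤ} (h : (n ^ 2 - 1) * m ≤ n * δ + (n + 1) * (rin - rout)) :
    m * n ^ 2 - m - (rin - rout) ≤ n * (δ + (rin - rout)) := by
  linarith

/-! ## §2. The polynomial identity -/

/-- **abc-iut-rh3-gen-2's identity**: `3(L+1)(n²−1) − n(L−1)(2L+5) = (L+1)·n·(3n−2L−1) + 3(2n−L−1)` (checked by hand by abc-iut-rh3-ref-1,
G6/B46; here by `ring`). It is what turns «licence at `n`» into «reach `(3n−1)/2`»: `3(L+1)·(licence numerator) − n·(cubic demand coefficient)`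
factors through `3n − 2L − 1`. [folklore] -/
theorem finReach_identity (L n : ℤ) :
    3 * (L + 1) * (n ^ 2 - 1) - n * (L - 1) * (2 * L + 5) = (L + 1) * n * (3 * n - 2 * L - 1) + 3 * (2 * n - L - 1) := by
  ring

/-! ## §3. The quantitative form (sign-free in `m`, `δ`) -/

/-- `sum_price_ge` (abc-iut-rh-typ-3, p484728) at the boundary `J = 0`, i.e. over the labels `1, …, L`:
`(δ+G)·L(L+1) + 2G·L ≤ 2·Σ_{k<L} price_{1+k}` (`0 < e`). [folklore] -/
theorem sum_price_ge_zero {e m δ rin rout : ℤ} (he : 0 < e) (L : ℕ) :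
    (δ + (rin - rout)) * ((L : ℤ) * (L + 1)) + 2 * (rin - rout) * L ≤
      2 * ∑ k ∈ range L, ((1 + (k : ℤ)) * δ + (1 + (k : ℤ) + 1) * (rin - rout) +
        ((1 + (k : ℤ)) ^ 2 * m - (1 + (k : ℤ)) * δ - (1 + (k : ℤ) + 1) * rin) % e) := by
  have h := sum_price_ge (m := m) (δ := δ) (rin := rin) (rout := rout) (J := 0) he L
  simp only [zero_add, mul_zero] at h
  exact h

/-- `six_mul_sum_demand_eq` (abc-iut-rh-typ-3, p484728) at the boundary `J = 0`: `6·Σ_{k<L} ((1+k)²−1)·m = m·L(L−1)(2L+5)` (`= 6m·S(L)`,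
`S` = abc-iut-rh2-w-1's `sum_range_sqSubOne`). [folklore] -/
theorem six_mul_sum_demand_eq_zero (m : ℤ) (L : ℕ) :
    6 * ∑ k ∈ range L, ((1 + (k : ℤ)) ^ 2 - 1) * m = m * ((L : ℤ) * (L - 1) * (2 * L + 5)) := by
  have h := six_mul_sum_demand_eq 0 m L
  simp only [zero_add, zero_mul, mul_zero, sub_zero] at h
  exact h

/-- **THE QUANTITATIVE FORM.** Licence at the label `n` (`0 < e`, `0 ≤ n`; NO sign hypothesis on `m`, `δ`, `r_in − r_out`):
`n·(6·Σ_{j=1}^{L} (price_j − d_j)) ≥ L·[(L+1)·(m·n·(3n−2L−1) − 3(e−1)) + 3·(m + (r_in−r_out))·(2n−L−1)]`.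
Proof: `3n × sum_price_ge_zero + 3L(L+1) × licence_cross_mul_of_hullCellδ − n × six_mul_sum_demand_eq_zero`, which is `finReach_identity`
after expansion (abc-iut-rh3-gen-2: «whence Σ/L ≥ (L+1)[mn(3n−2L−1) − 3(e−1)] + 3(m+G)(2n−L−1)», here with the factor `6n` kept on the left
so that no division occurs). [folklore] -/
theorem n_mul_six_mul_sum_slack_ge {e m n δ rin rout : ℤ} (he : 0 < e) (hn : 0 ≤ n) (hcell : HullCellδ e m n δ rin rout) (L : ℕ) :
    (L : ℤ) * ((L + 1) * (m * n * (3 * n - 2 * L - 1) - 3 * (e - 1)) + 3 * (m + (rin - rout)) * (2 * n - L - 1)) ≤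
      n * (6 * ∑ k ∈ range L, (((1 + (k : ℤ)) * δ + (1 + (k : ℤ) + 1) * (rin - rout) +
        ((1 + (k : ℤ)) ^ 2 * m - (1 + (k : ℤ)) * δ - (1 + (k : ℤ) + 1) * rin) % e) - ((1 + (k : ℤ)) ^ 2 - 1) * m)) := by
  rw [sum_sub_distrib]
  have hP := sum_price_ge_zero (m := m) (δ := δ) (rin := rin) (rout := rout) he L
  have hQ := licence_cross_mul_of_hullCellδ he hcell
  have hE := six_mul_sum_demand_eq_zero m L
  have hL0 : (0 : ℤ) ≤ L := Int.natCast_nonneg L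
  have h1 := mul_le_mul_of_nonneg_left hP hn
  have h2 := mul_le_mul_of_nonneg_left hQ (by positivity : (0 : ℤ) ≤ 3 * (L * (L + 1)))
  have h3 : (n : ℤ) * (6 * ∑ k ∈ range L, ((1 + (k : ℤ)) ^ 2 - 1) * m) = n * (m * ((L : ℤ) * (L - 1) * (2 * L + 5))) := by
    rw [hE]
  nlinarith [h1, h2, h3]

/-- Floor-free twin of the quantitative form: under the floor-free licence `(n²−1)·m ≤ n·δ + (n+1)·(r_in − r_out)` (`0 < e`, `0 ≤ n`)
`n·(6·Σ_{j=1}^{L} (price_j − d_j)) ≥ L·[(L+1)·m·n·(3n−2L−1) + 3·(m + (r_in−r_out))·(2n−L−1)]` — no `3(e−1)`. [folklore] -/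
theorem n_mul_six_mul_sum_slack_ge_of_linear {e m n δ rin rout : ℤ} (he : 0 < e) (hn : 0 ≤ n)
    (hlin : (n ^ 2 - 1) * m ≤ n * δ + (n + 1) * (rin - rout)) (L : ℕ) :
    (L : ℤ) * ((L + 1) * (m * n * (3 * n - 2 * L - 1)) + 3 * (m + (rin - rout)) * (2 * n - L - 1)) ≤
      n * (6 * ∑ k ∈ range L, (((1 + (k : ℤ)) * δ + (1 + (k : ℤ) + 1) * (rin - rout) +
        ((1 + (k : ℤ)) ^ 2 * m - (1 + (k : ℤ)) * δ - (1 + (k : ℤ) + 1) * rin) % e) - ((1 + (k : ℤ)) ^ 2 - 1) * m)) := by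
  rw [sum_sub_distrib]
  have hP := sum_price_ge_zero (m := m) (δ := δ) (rin := rin) (rout := rout) he L
  have hQ := licence_cross_mul_of_linear hlin
  have hE := six_mul_sum_demand_eq_zero m L
  have hL0 : (0 : ℤ) ≤ L := Int.natCast_nonneg L
  have h1 := mul_le_mul_of_nonneg_left hP hn
  have h2 := mul_le_mul_of_nonneg_left hQ (by positivity : (0 : ℤ) ≤ 3 * (L * (L + 1)))
  have h3 : (n : ℤ) * (6 * ∑ k ∈ range L, ((1 + (k : ℤ)) ^ 2 - 1) * m) = n * (m * ((L : ℤ) * (L - 1) * (2 * L + 5))) := by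
    rw [hE]
  nlinarith [h1, h2, h3]

/-! ## §4. FIN-REACH -/

/-- **The reach hypothesis forces `2L + 1 ≤ 3n`** when `0 < m`, `1 ≤ n`, `0 < e`: from `3(e−1) ≤ m·n·(3n−2L−1)` and `e ≥ 1` the product is
`≥ 0`, and `m·n ≥ 1`. (So the lemma never speaks above `(3n−1)/2`; in particular `2n − L − 1 ≥ 0`.) [folklore] -/
theorem two_mul_le_of_reach_hyp {e m n L : ℤ} (he : 0 < e) (hm : 0 < m) (hn : 1 ≤ n)
    (hL : 3 * (e - 1) ≤ m * n * (3 * n - 2 * L - 1)) : 2 * L + 1 ≤ 3 * n := by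
  by_contra hcon
  have hneg : 3 * n - 2 * L - 1 ≤ -1 := by omega
  have hmn : 1 ≤ m * n := by nlinarith
  nlinarith

/-- **The reach hypothesis is downward closed in `L`**: `3(e−1) ≤ m·n·(3n−2L−1)`, `L' ≤ L`, `0 ≤ m`, `0 ≤ n` ⟹ the same at `L'`
(rh3-gen-2's caveat (a) «the lemma gives every L below the bound»). [folklore] -/
theorem reach_hyp_mono {e m n L L' : ℤ} (hm : 0 ≤ m) (hn : 0 ≤ n) (hLL : L' ≤ L)
    (hL : 3 * (e - 1) ≤ m * n * (3 * n - 2 * L - 1)) : 3 * (e - 1) ≤ m * n * (3 * n - 2 * L' - 1) := by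
  have hmn : 0 ≤ m * n := mul_nonneg hm hn
  nlinarith

/-- **FIN-REACH, `0 < m` (no `δ`-hypothesis).** `0 < e`, `0 < m`, `r_out ≤ r_in`, `1 ≤ n`, `HullCellδ e m n δ r_in r_out` (licence at the ONE
label `n`) and `3(e−1) ≤ m·n·(3n−2L−1)` ⟹ `0 ≤ Σ_{j=1}^{L} (price_j − d_j)`: the netted exact slack of the labels `1, …, L` is non-negative —
licence at `n` FINANCES every label up to `L` (all `L ≤ (3n−1)/2 −` a floor allowance `≤ ⌈3(e−1)/(2mn)⌉`). From `n_mul_six_mul_sum_slack_ge`: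
the bracket is `≥ 0` termwise (`two_mul_le_of_reach_hyp` gives `2n − L − 1 ≥ 0`), then divide by `6n > 0`. [folklore] -/
theorem sum_slack_nonneg_of_hullCellδ_of_pos {e m n δ rin rout : ℤ} (he : 0 < e) (hm : 0 < m) (hio : rout ≤ rin) (hn : 1 ≤ n)
    (hcell : HullCellδ e m n δ rin rout) (L : ℕ) (hL : 3 * (e - 1) ≤ m * n * (3 * n - 2 * L - 1)) :
    0 ≤ ∑ k ∈ range L, (((1 + (k : ℤ)) * δ + (1 + (k : ℤ) + 1) * (rin - rout) +
        ((1 + (k : ℤ)) ^ 2 * m - (1 + (k : ℤ)) * δ - (1 + (k : ℤ) + 1) * rin) % e) - ((1 + (k : ℤ)) ^ 2 - 1) * m) := by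
  have hq := n_mul_six_mul_sum_slack_ge (m := m) (δ := δ) (rin := rin) (rout := rout) he (by omega) hcell L
  have h2L := two_mul_le_of_reach_hyp (L := (L : ℤ)) he hm hn hL
  have hL0 : (0 : ℤ) ≤ L := Int.natCast_nonneg L
  have hX : 0 ≤ m * n * (3 * n - 2 * (L : ℤ) - 1) - 3 * (e - 1) := by linarith
  have hY : 0 ≤ 3 * (m + (rin - rout)) * (2 * n - (L : ℤ) - 1) := by
    apply mul_nonneg (by omega) (by omega)
  have hbr : 0 ≤ (L : ℤ) * ((L + 1) * (m * n * (3 * n - 2 * L - 1) - 3 * (e - 1)) + 3 * (m + (rin - rout)) * (2 * n - L - 1)) := by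
    apply mul_nonneg hL0
    have := mul_nonneg (by omega : (0 : ℤ) ≤ L + 1) hX
    linarith
  have hn6 : (0 : ℤ) < n := by omega
  have h6 := le_trans hbr hq
  have h7 := (mul_nonneg_iff_of_pos_left hn6).mp h6
  linarith

/-- **FIN-REACH (abc-iut-rh3-gen-2 (A), with the needed `0 ≤ δ`).** `0 < e`, `0 ≤ m`, `0 ≤ δ`, `r_out ≤ r_in`, `1 ≤ n`,
`HullCellδ e m n δ r_in r_out` and `3(e−1) ≤ m·n·(3n−2L−1)` ⟹ `0 ≤ Σ_{j=1}^{L} (price_j − d_j)`. For `0 < m` this is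
`sum_slack_nonneg_of_hullCellδ_of_pos`; for `m = 0` every demand vanishes and every price `jδ + (j+1)G + ρ_j` is `≥ 0` (this is where `0 ≤ δ` is
used — WITHOUT it `m = 0`, `e = 1`, `δ = −2`, `r_in − r_out = 1`, `n = 1`, `L = 3` has all other hypotheses and `Σ = −3`; at a genuine cell
`δ = e_w·d_w ≥ e − 1 ≥ 0`, so nothing is lost). Numerics of record: 0 violations on 94,543 random licensed cells × 120 values of `L`
(rh3-gen-2 fincheck.py) and on the worked row (rh3-ref-1 G6) — here a theorem. [folklore] -/
theorem sum_slack_nonneg_of_hullCellδ {e m n δ rin rout : ℤ} (he : 0 < e) (hm : 0 ≤ m) (hδ : 0 ≤ δ) (hio : rout ≤ rin) (hn : 1 ≤ n)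
    (hcell : HullCellδ e m n δ rin rout) (L : ℕ) (hL : 3 * (e - 1) ≤ m * n * (3 * n - 2 * L - 1)) :
    0 ≤ ∑ k ∈ range L, (((1 + (k : ℤ)) * δ + (1 + (k : ℤ) + 1) * (rin - rout) +
        ((1 + (k : ℤ)) ^ 2 * m - (1 + (k : ℤ)) * δ - (1 + (k : ℤ) + 1) * rin) % e) - ((1 + (k : ℤ)) ^ 2 - 1) * m) := by
  rcases hm.eq_or_lt with hm0 | hmpos
  · -- `m = 0`: demands vanish, prices are non-negative termwise
    subst hm0
    refine sum_nonneg fun k _ => ?_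
    have h0 := (gain_bounds he 0 (1 + (k : ℤ)) δ rin).1
    have hk : (0 : ℤ) ≤ k := Int.natCast_nonneg k
    have hG : 0 ≤ rin - rout := by omega
    nlinarith [h0, hk, hG, hδ]
  · exact sum_slack_nonneg_of_hullCellδ_of_pos he hmpos hio hn hcell L hL

/-- **FIN-REACH, third repair (`L ≤ 2n − 1`, no sign on `m`'s positivity beyond `0 ≤ m`, no `δ`-hypothesis).** `0 < e`, `0 ≤ m`,
`r_out ≤ r_in`, `1 ≤ n`, licence at `n`, `3(e−1) ≤ m·n·(3n−2L−1)` and `L ≤ 2n − 1` ⟹ `0 ≤ Σ_{j=1}^{L} (price_j − d_j)` — the bracket of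
`n_mul_six_mul_sum_slack_ge` is then `≥ 0` termwise with no case split (abc-iut-rh3-tst-1 TEST-G2-FIN: «REPAIRED by ANY ONE of 1 ≤ m / 0 ≤ δ /
L ≤ 2n − 1»; this is the third). [folklore] -/
theorem sum_slack_nonneg_of_hullCellδ_of_le {e m n δ rin rout : ℤ} (he : 0 < e) (hm : 0 ≤ m) (hio : rout ≤ rin) (hn : 1 ≤ n)
    (hcell : HullCellδ e m n δ rin rout) (L : ℕ) (hL : 3 * (e - 1) ≤ m * n * (3 * n - 2 * L - 1))
    (hL2 : (L : ℤ) ≤ 2 * n - 1) :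
    0 ≤ ∑ k ∈ range L, (((1 + (k : ℤ)) * δ + (1 + (k : ℤ) + 1) * (rin - rout) +
        ((1 + (k : ℤ)) ^ 2 * m - (1 + (k : ℤ)) * δ - (1 + (k : ℤ) + 1) * rin) % e) - ((1 + (k : ℤ)) ^ 2 - 1) * m) := by
  have hq := n_mul_six_mul_sum_slack_ge (m := m) (δ := δ) (rin := rin) (rout := rout) he (by omega) hcell L
  have hL0 : (0 : ℤ) ≤ L := Int.natCast_nonneg L
  have hX : 0 ≤ m * n * (3 * n - 2 * (L : ℤ) - 1) - 3 * (e - 1) := by linarith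
  have hY : 0 ≤ 3 * (m + (rin - rout)) * (2 * n - (L : ℤ) - 1) := by
    apply mul_nonneg (by omega) (by omega)
  have hbr : 0 ≤ (L : ℤ) * ((L + 1) * (m * n * (3 * n - 2 * L - 1) - 3 * (e - 1)) + 3 * (m + (rin - rout)) * (2 * n - L - 1)) := by
    apply mul_nonneg hL0
    have := mul_nonneg (by omega : (0 : ℤ) ≤ L + 1) hX
    linarith
  have hn6 : (0 : ℤ) < n := by omega
  have h6 := le_trans hbr hq
  have h7 := (mul_nonneg_iff_of_pos_left hn6).mp h6
  linarith

/-- **Door sign**: the same conclusion written as the weighted door's netted hypothesis shape (p480491 `…weightedDeficit … ≤ 0` at the indicator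
weight `ω = 𝟙{j ≤ L}`, per place, in the exact model where deficit `= d_j − price_j`): `Σ_{j=1}^{L} (d_j − price_j) ≤ 0`. [folklore] -/
theorem sum_deficit_nonpos_of_hullCellδ {e m n δ rin rout : ℤ} (he : 0 < e) (hm : 0 ≤ m) (hδ : 0 ≤ δ) (hio : rout ≤ rin) (hn : 1 ≤ n)
    (hcell : HullCellδ e m n δ rin rout) (L : ℕ) (hL : 3 * (e - 1) ≤ m * n * (3 * n - 2 * L - 1)) :
    ∑ k ∈ range L, (((1 + (k : ℤ)) ^ 2 - 1) * m - ((1 + (k : ℤ)) * δ + (1 + (k : ℤ) + 1) * (rin - rout) +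
        ((1 + (k : ℤ)) ^ 2 * m - (1 + (k : ℤ)) * δ - (1 + (k : ℤ) + 1) * rin) % e)) ≤ 0 := by
  have h := sum_slack_nonneg_of_hullCellδ he hm hδ hio hn hcell L hL
  have hneg : ∑ k ∈ range L, (((1 + (k : ℤ)) ^ 2 - 1) * m - ((1 + (k : ℤ)) * δ + (1 + (k : ℤ) + 1) * (rin - rout) +
        ((1 + (k : ℤ)) ^ 2 * m - (1 + (k : ℤ)) * δ - (1 + (k : ℤ) + 1) * rin) % e)) =
      -∑ k ∈ range L, (((1 + (k : ℤ)) * δ + (1 + (k : ℤ) + 1) * (rin - rout) +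
        ((1 + (k : ℤ)) ^ 2 * m - (1 + (k : ℤ)) * δ - (1 + (k : ℤ) + 1) * rin) % e) - ((1 + (k : ℤ)) ^ 2 - 1) * m) := by
    rw [← sum_neg_distrib]
    refine sum_congr rfl fun k _ => ?_
    ring
  rw [hneg]
  linarith

/-- **R-W-margin form**: with `A_j := j²m − jδ − (j+1)r_in` the table's integer margin `m − (e·⌊A_j/e⌋ + (j+1)·r_out)` IS `price_j − d_j`
(abc-iut-rh2-tab-2 `HullCellSlackLaw.margin_eq_price_sub_demand`, p484618), so under the FIN-REACH hypotheses
`0 ≤ Σ_{j=1}^{L} (m − (e·⌊A_j/e⌋ + (j+1)·r_out))` — the per-place integer sum abc-iut-rh-typ-4's `cellSlack_settingPrVolSharp_eq` (p481438)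
converts into the typed cell slack. [folklore] -/
theorem sum_margin_nonneg_of_hullCellδ {e m n δ rin rout : ℤ} (he : 0 < e) (hm : 0 ≤ m) (hδ : 0 ≤ δ) (hio : rout ≤ rin) (hn : 1 ≤ n)
    (hcell : HullCellδ e m n δ rin rout) (L : ℕ) (hL : 3 * (e - 1) ≤ m * n * (3 * n - 2 * L - 1)) :
    0 ≤ ∑ k ∈ range L, (m - (e * (((1 + (k : ℤ)) ^ 2 * m - (1 + (k : ℤ)) * δ - (1 + (k : ℤ) + 1) * rin) / e) +
        (1 + (k : ℤ) + 1) * rout)) := by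
  have h := sum_slack_nonneg_of_hullCellδ he hm hδ hio hn hcell L hL
  have heq : ∑ k ∈ range L, (m - (e * (((1 + (k : ℤ)) ^ 2 * m - (1 + (k : ℤ)) * δ - (1 + (k : ℤ) + 1) * rin) / e) +
        (1 + (k : ℤ) + 1) * rout)) =
      ∑ k ∈ range L, (((1 + (k : ℤ)) * δ + (1 + (k : ℤ) + 1) * (rin - rout) +
        ((1 + (k : ℤ)) ^ 2 * m - (1 + (k : ℤ)) * δ - (1 + (k : ℤ) + 1) * rin) % e) - ((1 + (k : ℤ)) ^ 2 - 1) * m) :=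
    sum_congr rfl fun k _ => margin_eq_price_sub_demand e m (1 + (k : ℤ)) δ rin rout
  rw [heq]
  exact h

/-! ## §5. Corollaries: allowance form, floor-free flat reach -/

/-- **Allowance form**: if `3(e−1) ≤ m·n·A` (an integer floor ALLOWANCE `A ≥ 0`, e.g. `A = ⌈3(e−1)/(mn)⌉`) then every `L` with
`2L + 1 + A ≤ 3n` is financed: `0 ≤ Σ_{j=1}^{L} (price_j − d_j)` (`0 < e`, `0 ≤ m`, `0 ≤ δ`, `r_out ≤ r_in`, `1 ≤ n`, licence at `n`).
rh3-gen-2 (ii): «exact licence ⟹ reach ⌊(3n−1)/2⌋ − ⌈3(e−1)/(2mn)⌉»; with `m_q = e_w·H_w/(2l)` the allowance is `≤ ⌈6l/(κ·H_w·(l−1))⌉ ≤ ⌈7/κ⌉`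
labels, datum-free (their remark; not used here). [folklore] -/
theorem sum_slack_nonneg_of_hullCellδ_of_allowance {e m n δ rin rout A : ℤ} (he : 0 < e) (hm : 0 ≤ m) (hδ : 0 ≤ δ)
    (hio : rout ≤ rin) (hn : 1 ≤ n) (hcell : HullCellδ e m n δ rin rout) (hA : 3 * (e - 1) ≤ m * n * A) (L : ℕ)
    (hLA : 2 * (L : ℤ) + 1 + A ≤ 3 * n) :
    0 ≤ ∑ k ∈ range L, (((1 + (k : ℤ)) * δ + (1 + (k : ℤ) + 1) * (rin - rout) +
        ((1 + (k : ℤ)) ^ 2 * m - (1 + (k : ℤ)) * δ - (1 + (k : ℤ) + 1) * rin) % e) - ((1 + (k : ℤ)) ^ 2 - 1) * m) := by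
  refine sum_slack_nonneg_of_hullCellδ he hm hδ hio hn hcell L ?_
  have hmn : 0 ≤ m * n := mul_nonneg hm (by omega)
  nlinarith

/-- **Floor-free licence ⟹ FLAT reach `⌊(3n−1)/2⌋`** (rh3-gen-2 (i)): `0 < e`, `0 ≤ m`, `r_out ≤ r_in`, `1 ≤ n`, the floor-free licence
`(n²−1)·m ≤ n·δ + (n+1)·(r_in − r_out)` at `n` (`HullCellSlackSum.linear_le_price` side; it implies `HullCellδ` by `hullCellδ_of_linear`) ⟹ for
EVERY `L` with `2L + 1 ≤ 3n`: `0 ≤ Σ_{j=1}^{L} (price_j − d_j)` — no allowance, no `δ`-sign (for `2L+1 ≤ 3n` and `n ≥ 1` give `2n − L − 1 ≥ 0`,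
so both brackets of `n_mul_six_mul_sum_slack_ge_of_linear` are `≥ 0` even at `m = 0`). [folklore] -/
theorem sum_slack_nonneg_of_linear {e m n δ rin rout : ℤ} (he : 0 < e) (hm : 0 ≤ m) (hio : rout ≤ rin) (hn : 1 ≤ n)
    (hlin : (n ^ 2 - 1) * m ≤ n * δ + (n + 1) * (rin - rout)) (L : ℕ) (hL : 2 * (L : ℤ) + 1 ≤ 3 * n) :
    0 ≤ ∑ k ∈ range L, (((1 + (k : ℤ)) * δ + (1 + (k : ℤ) + 1) * (rin - rout) +
        ((1 + (k : ℤ)) ^ 2 * m - (1 + (k : ℤ)) * δ - (1 + (k : ℤ) + 1) * rin) % e) - ((1 + (k : ℤ)) ^ 2 - 1) * m) := by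
  have hq := n_mul_six_mul_sum_slack_ge_of_linear (m := m) (δ := δ) (rin := rin) (rout := rout) he (by omega) hlin L
  have hL0 : (0 : ℤ) ≤ L := Int.natCast_nonneg L
  have hmn : 0 ≤ m * n := mul_nonneg hm (by omega)
  have hX : 0 ≤ m * n * (3 * n - 2 * (L : ℤ) - 1) := mul_nonneg hmn (by omega)
  have hY : 0 ≤ 3 * (m + (rin - rout)) * (2 * n - (L : ℤ) - 1) := by
    apply mul_nonneg (by omega) (by omega)
  have hbr : 0 ≤ (L : ℤ) * ((L + 1) * (m * n * (3 * n - 2 * L - 1)) + 3 * (m + (rin - rout)) * (2 * n - L - 1)) := by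
    apply mul_nonneg hL0
    have := mul_nonneg (by omega : (0 : ℤ) ≤ L + 1) hX
    linarith
  have hn6 : (0 : ℤ) < n := by omega
  have h6 := le_trans hbr hq
  have h7 := (mul_nonneg_iff_of_pos_left hn6).mp h6
  linarith

/-! ## §6. Worked row (abc-iut-rh3-gen-2 §0, abc-iut-rh3-ref-1 G6 / B46): FREY `p = 7`, `l = 107` -/

/-- FREY `p = 7`, `l = 107`: `e = 1605`, `m = 210`, `δ = 1604`, `r_in = 268`, `r_out = −4472` (`l⋆ = 53`): the exact cell holds at the label `31`
and fails at `32` — the slice boundary `j₀ = 31` of record (rh3-gen-2 §0 / rh3-ref-1 G6 ✓). A fact about the listed integers; their link to the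
datum is the R-W WINDOW-TABLE certificate (computed ≠ proved). [folklore] -/
theorem row_frey7_l107_boundary :
    HullCellδ 1605 210 31 1604 268 (-4472) ∧ ¬ HullCellδ 1605 210 32 1604 268 (-4472) := by
  unfold HullCellδ
  decide

/-- Same row: the FIN-REACH hypothesis `3(e−1) ≤ m·n·(3n−2L−1)` at `n = 31` reads `4812 ≤ 6510·(92 − 2L)`; it holds at `L = 45` and fails at
`L = 46` — lemma reach `45` (rh3-ref-1 G6 ✓; `(3n−1)/2 = 46` = the exact cumulative `J⋆` of the table, one label above the certified reach).
[folklore] -/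
theorem row_frey7_l107_reach :
    3 * ((1605 : ℤ) - 1) ≤ 210 * 31 * (3 * 31 - 2 * 45 - 1) ∧ ¬ 3 * ((1605 : ℤ) - 1) ≤ 210 * 31 * (3 * 31 - 2 * 46 - 1) := by
  norm_num

/-- Same row, the instantiated FIN-REACH conclusion: the netted exact slack of the labels `1, …, 45` is `≥ 0` — from `sum_slack_nonneg_of_hullCellδ`
at `n = 31`, `L = 45` (LP-2 (2a) closed form on this place: `ω = 𝟙{j ≤ 45}` meets the netted constraint; D0121-SPEC §1.2 topt-pv-2's worked
instance is this place). [folklore] -/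
theorem row_frey7_l107_financed :
    0 ≤ ∑ k ∈ range 45, (((1 + (k : ℤ)) * 1604 + (1 + (k : ℤ) + 1) * (268 - (-4472)) +
        ((1 + (k : ℤ)) ^ 2 * 210 - (1 + (k : ℤ)) * 1604 - (1 + (k : ℤ) + 1) * 268) % 1605) - ((1 + (k : ℤ)) ^ 2 - 1) * 210) :=
  sum_slack_nonneg_of_hullCellδ (by norm_num) (by norm_num) (by norm_num) (by norm_num) (by norm_num)
    row_frey7_l107_boundary.1 45 (by norm_num)

/-- Same row, EXACT cumulative boundary by `decide` (rh3-gen-2 §0 / rh3-ref-1 G6 «exact J⋆ = 46» ✓): the netted exact slack of the labels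
`1, …, 46` is `86944 ≥ 0` and of `1, …, 47` is `−73760 < 0` — the certified reach `45` of `row_frey7_l107_reach` sits one label below the exact
`J⋆ = 46 = (3n−1)/2`; and the WHOLE place (`l⋆ = 53`) nets `−1332482 < 0` — NOT wholly financed (LAW A: `f_w = 31/53 < 2/3`;
`m·n·(3n − 2l⋆ − 1) = 6510·(−14) < 0`). Facts about the listed integers only. [folklore] -/
theorem row_frey7_l107_exact_reach :
    ∑ k ∈ range 46, (((1 + (k : ℤ)) * 1604 + (1 + (k : ℤ) + 1) * (268 - (-4472)) +
        ((1 + (k : ℤ)) ^ 2 * 210 - (1 + (k : ℤ)) * 1604 - (1 + (k : ℤ) + 1) * 268) % 1605) - ((1 + (k : ℤ)) ^ 2 - 1) * 210) = 86944 ∧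
    ∑ k ∈ range 47, (((1 + (k : ℤ)) * 1604 + (1 + (k : ℤ) + 1) * (268 - (-4472)) +
        ((1 + (k : ℤ)) ^ 2 * 210 - (1 + (k : ℤ)) * 1604 - (1 + (k : ℤ) + 1) * 268) % 1605) - ((1 + (k : ℤ)) ^ 2 - 1) * 210) = -73760 ∧
    ∑ k ∈ range 53, (((1 + (k : ℤ)) * 1604 + (1 + (k : ℤ) + 1) * (268 - (-4472)) +
        ((1 + (k : ℤ)) ^ 2 * 210 - (1 + (k : ℤ)) * 1604 - (1 + (k : ℤ) + 1) * 268) % 1605) - ((1 + (k : ℤ)) ^ 2 - 1) * 210) = -1332482 := by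
  decide

end Summit.ABC.IUTFork.Repair.RH.HullCellSlackFinReach
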